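import Summits.AtomisticToContinuum.Crystallization.Theorems.TwoCentreKissingKernelRobustTangencyBoundP34Cert
import Summits.AtomisticToContinuum.Crystallization.Theorems.TwoCentreKissingKernelRobustTangencyBoundPentagonIsolated
import HarnessLib

/-!
# `RobustTangencyBound` — the second pentagon lemma P{3,4}: a soft fan pentagon whose two
# middle-triangle base vertices are otherwise regular is impossible (step (III))

Route `TwoCentreKissingKernel`, item `stmt-AtomisticToContinuum-12082`, blueprint (III) §9.  Same soft pentagon
`p₁ … p₅` as `…PentagonIsolated.lean` (fan from `p₁`: facets `{p₁,p₂,p₃}`, `{p₁,p₃,p₄}`, `{p₁,p₄,p₅}`),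
but now only the vertices `p₃` and `p₄` are assumed otherwise regular (every other facet through them
is a soft triangle).  This is the variant that kills the "decahedral" family of the numerics
(`work/hybrid.py`).  The translation goes through the GENERIC layer `…ClusterSystem.lean`
(`clusterPt`, `clusterPt_mem`, `map_zOf_regVars_block`, `clusterHs_eval`) and the 36 kernel
certificates `p34Claim_holds` (`…P34Cert.lean`).
-/

noncomputable section

namespace Summit.AtomisticToContinuum.Crystallization.Theorems

open Real RealInnerProductSpace InnerProductGeometry Literature.Geometry.DiscreteGeometry
  Literature.Analysis.ValidatedNumerics Finset

/-- **The algebraic core of P{3,4}** (generic layer): admissible data would solve `p34Claim`. -/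
theorem p34_core_false {α : Type*} {x₁ x₂ s₁₂ s₂₃ s₃₄ s₄₅ s₅₁ : ℝ} {L3 L4 : List α}
    {C3 S3 C4 S4 : α → ℝ} (hm3 : L3.length ≤ 5) (hm4 : L4.length ≤ 5)
    (hbase : List.Forall₂ InIvl
      [(((-51 : ℚ)) / 100, (502 : ℚ) / 1000), (((-51 : ℚ)) / 100, (502 : ℚ) / 1000),
        ((497 : ℚ) / 1000, (502 : ℚ) / 1000), ((497 : ℚ) / 1000, (502 : ℚ) / 1000),
        ((497 : ℚ) / 1000, (502 : ℚ) / 1000), ((497 : ℚ) / 1000, (502 : ℚ) / 1000),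
        ((497 : ℚ) / 1000, (502 : ℚ) / 1000)]
      [x₁, x₂, s₁₂, s₂₃, s₃₄, s₄₅, s₅₁])
    (hw3 : ∀ c ∈ L3, InIvl ((3252 : ℚ) / 10000, (3415 : ℚ) / 10000) (C3 c) ∧
      InIvl ((9398 : ℚ) / 10000, (9457 : ℚ) / 10000) (S3 c))
    (hw4 : ∀ c ∈ L4, InIvl ((3252 : ℚ) / 10000, (3415 : ℚ) / 10000) (C4 c) ∧
      InIvl ((9398 : ℚ) / 10000, (9457 : ℚ) / 10000) (S4 c))
    (hc3 : ∀ c ∈ L3, S3 c ^ 2 + C3 c ^ 2 = 1) (hc4 : ∀ c ∈ L4, S4 c ^ 2 + C4 c ^ 2 = 1)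
    (hprod3 : zOf (clusterPt [x₁, x₂, s₁₂, s₂₃, s₃₄, s₄₅, s₅₁] [(L3, C3, S3), (L4, C4, S4)]) p34A *
      (zOf (clusterPt [x₁, x₂, s₁₂, s₂₃, s₃₄, s₄₅, s₅₁] [(L3, C3, S3), (L4, C4, S4)]) p34B *
        (L3.map fun c => ((C3 c : ℝ) : ℂ) + ((S3 c : ℝ) : ℂ) * Complex.I).prod) = 1)
    (hprod4 : zOf (clusterPt [x₁, x₂, s₁₂, s₂₃, s₃₄, s₄₅, s₅₁] [(L3, C3, S3), (L4, C4, S4)]) p34C *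
      (zOf (clusterPt [x₁, x₂, s₁₂, s₂₃, s₃₄, s₄₅, s₅₁] [(L3, C3, S3), (L4, C4, S4)]) p34D *
        (L4.map fun c => ((C4 c : ℝ) : ℂ) + ((S4 c : ℝ) : ℂ) * Complex.I).prod) = 1) : False := by
  set base : List ℝ := [x₁, x₂, s₁₂, s₂₃, s₃₄, s₄₅, s₅₁] with hbase_def
  set B : List (List α × (α → ℝ) × (α → ℝ)) := [(L3, C3, S3), (L4, C4, S4)] with hB
  set pt := clusterPt base B with hpt
  set W3 : List ℂ := L3.map fun c => ((C3 c : ℝ) : ℂ) + ((S3 c : ℝ) : ℂ) * Complex.I with hW3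
  set W4 : List ℂ := L4.map fun c => ((C4 c : ℝ) : ℂ) + ((S4 c : ℝ) : ℂ) * Complex.I with hW4
  -- box membership
  have hB' : ∀ b ∈ B, ∀ c ∈ b.1, InIvl ((3252 : ℚ) / 10000, (3415 : ℚ) / 10000) (b.2.1 c) ∧
      InIvl ((9398 : ℚ) / 10000, (9457 : ℚ) / 10000) (b.2.2 c) := by
    intro b hb
    simp only [hB, List.mem_cons, List.mem_nil_iff, or_false] at hb
    rcases hb with rfl | rfl
    · exact hw3
    · exact hw4
  have hmem0 := clusterPt_mem base B hbase hB'
  have hbox : pentBox L3.length L4.length 0 =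
      [(((-51 : ℚ)) / 100, (502 : ℚ) / 1000), (((-51 : ℚ)) / 100, (502 : ℚ) / 1000),
        ((497 : ℚ) / 1000, (502 : ℚ) / 1000), ((497 : ℚ) / 1000, (502 : ℚ) / 1000),
        ((497 : ℚ) / 1000, (502 : ℚ) / 1000), ((497 : ℚ) / 1000, (502 : ℚ) / 1000),
        ((497 : ℚ) / 1000, (502 : ℚ) / 1000)] ++
      (List.replicate ((B.map fun b => b.1.length).sum) [((3252 : ℚ) / 10000, (3415 : ℚ) / 10000),
        ((9398 : ℚ) / 10000, (9457 : ℚ) / 10000)]).flatten := by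
    simp [pentBox, hB, List.replicate]
  have hmem : Box.mem (pentBox L3.length L4.length 0) pt := by rw [hbox]; exact hmem0
  -- the equations
  have hlen7 : base.length = 7 := by simp [hbase_def]
  have hreg : ∀ (k : ℕ) (hk : k < [W3, W4].length),
      (regVars (7 + 2 * ((([W3, W4] : List (List ℂ)).take k).map List.length).sum)
        (([W3, W4] : List (List ℂ))[k]).length).map (zOf pt) = ([W3, W4] : List (List ℂ))[k] := by
    intro k hk
    have hk2 : k = 0 ∨ k = 1 := by simp at hk; omega
    rcases hk2 with rfl | rfl
    · have h := map_zOf_regVars_block base B (k := 0) (by simp [hB])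
      rw [hlen7, blockOff_zero, add_zero] at h
      simpa [hB, hW3] using h
    · have h := map_zOf_regVars_block base B (k := 1) (by simp [hB])
      have hoff : blockOff B 1 = 2 * L3.length := by simp [hB, blockOff]
      rw [hlen7, hoff] at h
      simpa [hB, hW3, hW4] using h
  have hunit : ∀ (k : ℕ) (hk : k < [W3, W4].length), ∀ w ∈ ([W3, W4] : List (List ℂ))[k],
      w.re ^ 2 + w.im ^ 2 = 1 := by
    intro k hk w hw
    have hk2 : k = 0 ∨ k = 1 := by simp at hk; omega
    rcases hk2 with rfl | rfl
    · simp only [List.getElem_cons_zero, hW3, List.mem_map] at hw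
      obtain ⟨c, hc, rfl⟩ := hw
      have := hc3 c hc
      simp; linarith
    · simp only [List.getElem_cons_succ, List.getElem_cons_zero, hW4, List.mem_map] at hw
      obtain ⟨c, hc, rfl⟩ := hw
      have := hc4 c hc
      simp; linarith
  have hprod : ∀ (k : ℕ) (hk : k < [W3, W4].length) (hk' : k < p34Facs.length),
      ((p34Facs[k]).map (zOf pt)).prod * (([W3, W4] : List (List ℂ))[k]).prod = 1 := by
    intro k hk hk'
    have hk2 : k = 0 ∨ k = 1 := by simp at hk; omega
    rcases hk2 with rfl | rfl
    · simp only [p34Facs, List.getElem_cons_zero, List.map_cons, List.map_nil, List.prod_cons,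
        List.prod_nil, mul_one]
      simpa only [mul_assoc, hW3] using hprod3
    · simp only [p34Facs, List.getElem_cons_succ, List.getElem_cons_zero, List.map_cons, List.map_nil,
        List.prod_cons, List.prod_nil, mul_one]
      simpa only [mul_assoc, hW4] using hprod4
  have hhs0 := clusterHs_eval pt p34Facs [W3, W4] 7 (by simp [p34Facs]) hreg hunit hprod
  have hhs : ∀ e ∈ clusterHs p34Facs [L3.length, L4.length] 7, e.eval pt = 0 := by
    simpa [hW3, hW4] using hhs0
  exact p34Claim_holds L3.length L4.length hm3 hm4 pt hmem
    ⟨fun g hg => by simp [p34Claim] at hg, hhs⟩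

/-- **The pentagon lemma P{3,4}.** A soft pentagon `p₁ … p₅` of the hull (fan from `p₁`), with every
other facet through `p₃` and through `p₄` a soft triangle, is impossible (`0 ≤ η ≤ 10⁻³`). -/
theorem false_of_soft_pentagon_34 {X : Finset (EuclideanSpace ℝ (Fin 3))}
    (hX1 : ∀ z ∈ X, ‖z‖ = 1)
    (h0 : (0 : EuclideanSpace ℝ (Fin 3)) ∈ interior (convexHull ℝ (X : Set (EuclideanSpace ℝ (Fin 3)))))
    {η : ℝ} (hη0 : 0 ≤ η) (hη : η ≤ 1 / 1000)
    (hsep : ∀ p ∈ X, ∀ q ∈ X, p ≠ q → ⟪p, q⟫ ≤ 1 / 2 + 2 * η)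
    {p₁ p₂ p₃ p₄ p₅ : EuclideanSpace ℝ (Fin 3)} (hp₁ : p₁ ∈ X) (hp₂ : p₂ ∈ X) (hp₃ : p₃ ∈ X)
    (hp₄ : p₄ ∈ X) (hp₅ : p₅ ∈ X)
    (h12 : p₁ ≠ p₂) (h13 : p₁ ≠ p₃) (h14 : p₁ ≠ p₄) (h15 : p₁ ≠ p₅) (h23 : p₂ ≠ p₃)
    (h24 : p₂ ≠ p₄) (h34 : p₃ ≠ p₄) (h35 : p₃ ≠ p₅) (h45 : p₄ ≠ p₅)
    (s12 : 1 / 2 - 3 * η ≤ ⟪p₁, p₂⟫) (s23 : 1 / 2 - 3 * η ≤ ⟪p₂, p₃⟫) (s34 : 1 / 2 - 3 * η ≤ ⟪p₃, p₄⟫)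
    (s45 : 1 / 2 - 3 * η ≤ ⟪p₄, p₅⟫) (s51 : 1 / 2 - 3 * η ≤ ⟪p₅, p₁⟫)
    {c₁₂₃ c₁₃₄ c₁₄₅ : EuclideanSpace ℝ (Fin 3)}
    (hc₁₂₃ : c₁₂₃ ∈ facetNormals X) (hT₁₂₃ : tightSet X c₁₂₃ = {p₁, p₂, p₃})
    (hc₁₃₄ : c₁₃₄ ∈ facetNormals X) (hT₁₃₄ : tightSet X c₁₃₄ = {p₁, p₃, p₄})
    (hc₁₄₅ : c₁₄₅ ∈ facetNormals X) (hT₁₄₅ : tightSet X c₁₄₅ = {p₁, p₄, p₅})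
    (hreg3 : ∀ c' ∈ facetNormals X, ⟪c', p₃⟫ = 1 → c' ≠ c₁₂₃ → c' ≠ c₁₃₄ → SoftTriangleAt η X c' p₃)
    (hreg4 : ∀ c' ∈ facetNormals X, ⟪c', p₄⟫ = 1 → c' ≠ c₁₃₄ → c' ≠ c₁₄₅ → SoftTriangleAt η X c' p₄) :
    False := by
  classical
  -- windows of the base quantities
  have u12 := hsep p₁ hp₁ p₂ hp₂ h12
  have u23 := hsep p₂ hp₂ p₃ hp₃ h23
  have u34 := hsep p₃ hp₃ p₄ hp₄ h34
  have u45 := hsep p₄ hp₄ p₅ hp₅ h45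
  have u51 := hsep p₅ hp₅ p₁ hp₁ h15.symm
  have ux1 : ⟪p₁, p₃⟫ ≤ 1 / 2 + 2 * η := hsep p₁ hp₁ p₃ hp₃ h13
  have ux2 : ⟪p₁, p₄⟫ ≤ 1 / 2 + 2 * η := hsep p₁ hp₁ p₄ hp₄ h14
  have lx1 : -51 / 100 ≤ ⟪p₁, p₃⟫ := by
    have e1 : ⟪p₂, p₁⟫ = ⟪p₁, p₂⟫ := real_inner_comm _ _
    exact inner_diag_ge_of_soft (hX1 _ hp₂) (hX1 _ hp₁) (hX1 _ hp₃) (by rw [e1]; linarith)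
      (by rw [e1]; linarith) (by linarith) (by linarith)
  have lx2 : -51 / 100 ≤ ⟪p₁, p₄⟫ := by
    have e1 : ⟪p₅, p₄⟫ = ⟪p₄, p₅⟫ := real_inner_comm _ _
    have := inner_diag_ge_of_soft (hX1 _ hp₅) (hX1 _ hp₄) (hX1 _ hp₁) (by rw [e1]; linarith)
      (by rw [e1]; linarith) (by linarith) (by linarith)
    rwa [real_inner_comm] at this
  -- the cluster facets are distinct
  have m3T123 : p₃ ∈ tightSet X c₁₂₃ := by rw [hT₁₂₃]; simp
  have m2T123 : p₂ ∈ tightSet X c₁₂₃ := by rw [hT₁₂₃]; simp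
  have m3T134 : p₃ ∈ tightSet X c₁₃₄ := by rw [hT₁₃₄]; simp
  have m4T134 : p₄ ∈ tightSet X c₁₃₄ := by rw [hT₁₃₄]; simp
  have m4T145 : p₄ ∈ tightSet X c₁₄₅ := by rw [hT₁₄₅]; simp
  have hne12 : c₁₂₃ ≠ c₁₃₄ := by
    intro h
    have : p₂ ∈ tightSet X c₁₃₄ := h ▸ m2T123
    rw [hT₁₃₄, mem_insert, mem_insert, mem_singleton] at this
    rcases this with h | h | h
    · exact h12 h.symm
    · exact h23 h
    · exact h24 h
  have hne23 : c₁₃₄ ≠ c₁₄₅ := by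
    intro h
    have : p₃ ∈ tightSet X c₁₄₅ := h ▸ m3T134
    rw [hT₁₄₅, mem_insert, mem_insert, mem_singleton] at this
    rcases this with h | h | h
    · exact h13 h.symm
    · exact h34 h
    · exact h35 h
  -- facets through `p₃` and `p₄`
  set S3 := (facetNormals X).filter (fun c' => ⟪c', p₃⟫ = 1) with hS3
  set S4 := (facetNormals X).filter (fun c' => ⟪c', p₄⟫ = 1) with hS4
  have hc3a : c₁₂₃ ∈ S3 := mem_filter.2 ⟨hc₁₂₃, (mem_tightSet.1 m3T123).2⟩
  have hc3b : c₁₃₄ ∈ S3.erase c₁₂₃ := mem_erase.2 ⟨hne12.symm, mem_filter.2 ⟨hc₁₃₄, (mem_tightSet.1 m3T134).2⟩⟩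
  have hc4a : c₁₃₄ ∈ S4 := mem_filter.2 ⟨hc₁₃₄, (mem_tightSet.1 m4T134).2⟩
  have hc4b : c₁₄₅ ∈ S4.erase c₁₃₄ := mem_erase.2 ⟨hne23.symm, mem_filter.2 ⟨hc₁₄₅, (mem_tightSet.1 m4T145).2⟩⟩
  set R3 := (S3.erase c₁₂₃).erase c₁₃₄ with hR3
  set R4 := (S4.erase c₁₃₄).erase c₁₄₅ with hR4
  have hR3sub : R3 ⊆ S3 := (erase_subset _ _).trans (erase_subset _ _)
  have hR4sub : R4 ⊆ S4 := (erase_subset _ _).trans (erase_subset _ _)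
  have hR3reg : ∀ c' ∈ R3, SoftTriangleAt η X c' p₃ := by
    intro c' hc'
    obtain ⟨h2, hc''⟩ := mem_erase.1 hc'
    obtain ⟨h1, hS⟩ := mem_erase.1 hc''
    obtain ⟨hF, hcy⟩ := mem_filter.1 hS
    exact hreg3 c' hF hcy h1 h2
  have hR4reg : ∀ c' ∈ R4, SoftTriangleAt η X c' p₄ := by
    intro c' hc'
    obtain ⟨h2, hc''⟩ := mem_erase.1 hc'
    obtain ⟨h1, hS⟩ := mem_erase.1 hc''
    obtain ⟨hF, hcy⟩ := mem_filter.1 hS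
    exact hreg4 c' hF hcy h1 h2
  have hm3 : R3.toList.length ≤ 5 := by
    rw [length_toList]; exact card_le_five_of_softTriangles hX1 h0 hη0 hη hsep hp₃ hR3sub hR3reg
  have hm4 : R4.toList.length ≤ 5 := by
    rw [length_toList]; exact card_le_five_of_softTriangles hX1 h0 hη0 hη hsep hp₄ hR4sub hR4reg
  have hw3 : ∀ c' ∈ R3.toList,
      InIvl ((3252 : ℚ) / 10000, (3415 : ℚ) / 10000) (Real.cos (cornerAngle X c' p₃)) ∧
      InIvl ((9398 : ℚ) / 10000, (9457 : ℚ) / 10000) (Real.sin (cornerAngle X c' p₃)) := fun c' hc' =>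
    (window_of_softTriangleAt hX1 h0 hη0 hη hsep (mem_filter.1 (hR3sub (mem_toList.1 hc'))).1 hp₃
      (hR3reg c' (mem_toList.1 hc'))).1
  have hw4 : ∀ c' ∈ R4.toList,
      InIvl ((3252 : ℚ) / 10000, (3415 : ℚ) / 10000) (Real.cos (cornerAngle X c' p₄)) ∧
      InIvl ((9398 : ℚ) / 10000, (9457 : ℚ) / 10000) (Real.sin (cornerAngle X c' p₄)) := fun c' hc' =>
    (window_of_softTriangleAt hX1 h0 hη0 hη hsep (mem_filter.1 (hR4sub (mem_toList.1 hc'))).1 hp₄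
      (hR4reg c' (mem_toList.1 hc'))).1
  -- vertex conditions in product form
  set z : EuclideanSpace ℝ (Fin 3) → EuclideanSpace ℝ (Fin 3) → ℂ :=
    fun c' y => (Real.cos (cornerAngle X c' y) : ℂ) + (Real.sin (cornerAngle X c' y) : ℂ) * Complex.I
    with hz
  have hprod3 : z c₁₂₃ p₃ * (z c₁₃₄ p₃ * (R3.toList.map fun c' => z c' p₃).prod) = 1 := by
    have h := vertex_product_eq_one hX1 h0 hp₃
    rw [← mul_prod_erase S3 _ hc3a, ← mul_prod_erase (S3.erase c₁₂₃) _ hc3b] at h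
    rw [prod_map_toList]; exact h
  have hprod4 : z c₁₃₄ p₄ * (z c₁₄₅ p₄ * (R4.toList.map fun c' => z c' p₄).prod) = 1 := by
    have h := vertex_product_eq_one hX1 h0 hp₄
    rw [← mul_prod_erase S4 _ hc4a, ← mul_prod_erase (S4.erase c₁₃₄) _ hc4b] at h
    rw [prod_map_toList]; exact h
  -- the four cluster corners in forward form
  have q31 : ⟪p₃, p₁⟫ ^ 2 < 1 := by rw [real_inner_comm]; nlinarith only [lx1, ux1, hη]
  have q32 : ⟪p₃, p₂⟫ ^ 2 < 1 := by rw [real_inner_comm]; exact sq_lt_one_of_window hη0 hη s23 u23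
  have q34' : ⟪p₃, p₄⟫ ^ 2 < 1 := sq_lt_one_of_window hη0 hη s34 u34
  have q41 : ⟪p₄, p₁⟫ ^ 2 < 1 := by rw [real_inner_comm]; nlinarith only [lx2, ux2, hη]
  have q43 : ⟪p₄, p₃⟫ ^ 2 < 1 := by rw [real_inner_comm]; exact q34'
  have q45 : ⟪p₄, p₅⟫ ^ 2 < 1 := sq_lt_one_of_window hη0 hη s45 u45
  have hT3a : tightSet X c₁₂₃ = {p₃, p₁, p₂} := by
    rw [hT₁₂₃]; ext t; simp only [mem_insert, mem_singleton]; tauto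
  have hT3b : tightSet X c₁₃₄ = {p₃, p₁, p₄} := by
    rw [hT₁₃₄]; ext t; simp only [mem_insert, mem_singleton]; tauto
  have hT4b : tightSet X c₁₃₄ = {p₄, p₁, p₃} := by
    rw [hT₁₃₄]; ext t; simp only [mem_insert, mem_singleton]; tauto
  have hT4c : tightSet X c₁₄₅ = {p₄, p₁, p₅} := by
    rw [hT₁₄₅]; ext t; simp only [mem_insert, mem_singleton]; tauto
  have hθA : cornerAngle X c₁₂₃ p₃ = angle (perpTo p₃ p₁) (perpTo p₃ p₂) :=
    cornerAngle_triangle hX1 h0 hc₁₂₃ hT3a h13.symm h23.symm h12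
  have hθB : cornerAngle X c₁₃₄ p₃ = angle (perpTo p₃ p₁) (perpTo p₃ p₄) :=
    cornerAngle_triangle hX1 h0 hc₁₃₄ hT3b h13.symm h34 h14
  have hθC : cornerAngle X c₁₃₄ p₄ = angle (perpTo p₄ p₁) (perpTo p₄ p₃) :=
    cornerAngle_triangle hX1 h0 hc₁₃₄ hT4b h14.symm h34.symm h13
  have hθD : cornerAngle X c₁₄₅ p₄ = angle (perpTo p₄ p₁) (perpTo p₄ p₅) :=
    cornerAngle_triangle hX1 h0 hc₁₄₅ hT4c h14.symm h45 h15
  obtain ⟨CA, SA⟩ := corner_forward (hX1 _ hp₃) (hX1 _ hp₁) (hX1 _ hp₂) q31 q32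
  obtain ⟨CB, SB⟩ := corner_forward (hX1 _ hp₃) (hX1 _ hp₁) (hX1 _ hp₄) q31 q34'
  obtain ⟨CC, SC⟩ := corner_forward (hX1 _ hp₄) (hX1 _ hp₁) (hX1 _ hp₃) q41 q43
  obtain ⟨CD, SD⟩ := corner_forward (hX1 _ hp₄) (hX1 _ hp₁) (hX1 _ hp₅) q41 q45
  -- the candidate point and the evaluation of the four corners
  set base : List ℝ := [⟪p₁, p₃⟫, ⟪p₁, p₄⟫, ⟪p₁, p₂⟫, ⟪p₂, p₃⟫, ⟪p₃, p₄⟫, ⟪p₄, p₅⟫, ⟪p₅, p₁⟫] with hbase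
  set B : List (List (EuclideanSpace ℝ (Fin 3)) × (EuclideanSpace ℝ (Fin 3) → ℝ) ×
      (EuclideanSpace ℝ (Fin 3) → ℝ)) :=
    [(R3.toList, (fun c' => Real.cos (cornerAngle X c' p₃)), (fun c' => Real.sin (cornerAngle X c' p₃))),
      (R4.toList, (fun c' => Real.cos (cornerAngle X c' p₄)), (fun c' => Real.sin (cornerAngle X c' p₄)))]
    with hB
  set pt := clusterPt base B with hpt
  have e0 : pt 0 = ⟪p₁, p₃⟫ := by rw [hpt, clusterPt_lt base B (by simp [hbase])]; simp [hbase]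
  have e1 : pt 1 = ⟪p₁, p₄⟫ := by rw [hpt, clusterPt_lt base B (by simp [hbase])]; simp [hbase]
  have e2 : pt 2 = ⟪p₁, p₂⟫ := by rw [hpt, clusterPt_lt base B (by simp [hbase])]; simp [hbase]
  have e3 : pt 3 = ⟪p₂, p₃⟫ := by rw [hpt, clusterPt_lt base B (by simp [hbase])]; simp [hbase]
  have e4 : pt 4 = ⟪p₃, p₄⟫ := by rw [hpt, clusterPt_lt base B (by simp [hbase])]; simp [hbase]
  have e5 : pt 5 = ⟪p₄, p₅⟫ := by rw [hpt, clusterPt_lt base B (by simp [hbase])]; simp [hbase]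
  have e6 : pt 6 = ⟪p₅, p₁⟫ := by rw [hpt, clusterPt_lt base B (by simp [hbase])]; simp [hbase]
  have c31 : ⟪p₃, p₁⟫ = ⟪p₁, p₃⟫ := real_inner_comm _ _
  have c32 : ⟪p₃, p₂⟫ = ⟪p₂, p₃⟫ := real_inner_comm _ _
  have c41 : ⟪p₄, p₁⟫ = ⟪p₁, p₄⟫ := real_inner_comm _ _
  have c43 : ⟪p₄, p₃⟫ = ⟪p₃, p₄⟫ := real_inner_comm _ _
  have c15 : ⟪p₁, p₅⟫ = ⟪p₅, p₁⟫ := real_inner_comm _ _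
  have hzA : zOf pt p34A = z c₁₂₃ p₃ := by
    rw [p34A, zOf_cornerR, hz]
    simp only [RExpr.eval, e0, e2, e3, hθA, CA, SA, c31, c32]
    push_cast; ring_nf
  have hzB : zOf pt p34B = z c₁₃₄ p₃ := by
    rw [p34B, zOf_cornerR, hz]
    simp only [RExpr.eval, e0, e1, e4, hθB, CB, SB, c31]
    push_cast; ring_nf
  have hzC : zOf pt p34C = z c₁₃₄ p₄ := by
    rw [p34C, zOf_cornerR, hz]
    simp only [RExpr.eval, e0, e1, e4, hθC, CC, SC, c41, c43]
    push_cast; ring_nf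
  have hzD : zOf pt p34D = z c₁₄₅ p₄ := by
    rw [p34D, zOf_cornerR, hz]
    simp only [RExpr.eval, e1, e5, e6, hθD, CD, SD, c41, c15]
    push_cast; ring_nf
  rw [← hzA, ← hzB] at hprod3
  rw [← hzC, ← hzD] at hprod4
  -- the algebraic core
  have iv : ∀ {t : ℝ}, 1 / 2 - 3 * η ≤ t → t ≤ 1 / 2 + 2 * η →
      InIvl ((497 : ℚ) / 1000, (502 : ℚ) / 1000) t := fun h1 h2 => by
    simp only [InIvl]; push_cast; constructor <;> linarith only [h1, h2, hη0, hη]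
  have ix : ∀ {t : ℝ}, -51 / 100 ≤ t → t ≤ 1 / 2 + 2 * η →
      InIvl (((-51 : ℚ)) / 100, (502 : ℚ) / 1000) t := fun h1 h2 => by
    simp only [InIvl]; push_cast; constructor <;> linarith only [h1, h2, hη0, hη]
  have hbaseF : List.Forall₂ InIvl
      [(((-51 : ℚ)) / 100, (502 : ℚ) / 1000), (((-51 : ℚ)) / 100, (502 : ℚ) / 1000),
        ((497 : ℚ) / 1000, (502 : ℚ) / 1000), ((497 : ℚ) / 1000, (502 : ℚ) / 1000),
        ((497 : ℚ) / 1000, (502 : ℚ) / 1000), ((497 : ℚ) / 1000, (502 : ℚ) / 1000),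
        ((497 : ℚ) / 1000, (502 : ℚ) / 1000)] base :=
    List.Forall₂.cons (ix lx1 ux1) (List.Forall₂.cons (ix lx2 ux2) (List.Forall₂.cons (iv s12 u12)
      (List.Forall₂.cons (iv s23 u23) (List.Forall₂.cons (iv s34 u34) (List.Forall₂.cons (iv s45 u45)
        (List.Forall₂.cons (iv s51 u51) List.Forall₂.nil))))))
  exact p34_core_false hm3 hm4 hbaseF hw3 hw4 (fun c' _ => Real.sin_sq_add_cos_sq _)
    (fun c' _ => Real.sin_sq_add_cos_sq _) hprod3 hprod4

end Summit.AtomisticToContinuum.Crystallization.Theorems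

end
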